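import Summits.Ventures.LatticeQCDFlow.Scaling.SectorExactMixing
import Summits.Ventures.LatticeQCDFlow.Scaling.DominatedStarRegimeFreeTimeAverages

/-!
HONEST FRAMING: exact (Metropolis-corrected) sampling algorithms for lattice gauge theory; figures
of merit are autocorrelation/cost numbers at stated couplings and volumes; no continuum-physics
claim.

# SectorExactSampleSize — THE HONEST SAMPLE SIZE WITH SECTOR-EXACT FLOWS ON A GENERAL STATE SPACE, FROM EVERY START, WITH NOTHING
# OF THE VOLUME IN IT: BURN-IN `r ≥ ⌈ρ⁻¹·log(4(1 + K(2t+h)/(2t))/ε)⌉`, RUN `N ≥ (4Var_π̃(f)/(η²ε))/(p·min{ct/(3m), h/(7K)})` ⇒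
# `P_x{|N⁻¹Σ_{s<N} f(X_{r+s}) − E_π̃ f| ≥ η} ≤ ε` (lean-2 GEN-30, ours)

Venture-side (OURS).  Cell `lqcd-flow` (pub-lqcd), unit `pub-lqcd-lean-2-g30`, 2026-08-28.  Chapter Q (item 1 for sector-exact maps on a general
`S`), file 7 — the practical form.  The volume-free burn-in of `Scaling/SectorExactMixing` (sector-exact flows of sector-weight quality `a`)
combined with chapter N's regime-free gap `Gap ≥ p·min{ct/(3m), (1−t)w_0/(7K)}` (`Scaling/DominatedStarRegimeFreeGap`, one-sided domination
`p·μ_l(φ_r u) ≤ μ_0(u)`, i.e. `c_r ≤ 1/p`) in Levin–Peres–Wilmer's Theorem 12.21 (`Literature/Probability/MarkovChains/TimeAverageConcentration`).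

## What is proved

* **`sectorExact_timeAverage`** — general finite `S`, sector `A` charged by every law, `K ≥ 1` cold laws and a hot law, hub list with
  multiplicities `≥ c ≥ 1`, entry maps preserving `A` with `μ_l(φ_r u) = c_r(u)μ_0(u)` and `p·μ_l(φ_r u) ≤ μ_0(u)`, exact hot redraws,
  `μ_k`-reversible sector-confined cold kernels, `0 < t < 1`, `w_0 > 0`, sector-weight quality `0 < a ≤ min{1, cin_r/cout_r, cout_r/cin_r}`:
  from EVERY start `x`, with burn-in `r ≥ ⌈ρ⁻¹·log(2(1 + K(2t+h)/(2t))/(ε/2))⌉` (`ρ = (th/(2t+h))·min{ac/m, 1/(K+1)}`) and run length `N ≥ 1`,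
  `N ≥ (4Var_π̃(f)/(η²ε))·(1/(p·min{ct/(3m), h/(7K)}))`, the time average of any `f` deviates from `E_π̃ f` by `≥ η` with probability `≤ ε`.

Reading (no numerics implied): for the topological-freezing scenario (within-sector HMC on the cold replicas, a flow hub exact within
sectors) the whole honest-sampling recipe is volume-free for every number of replicas: `O((K + m/(ac))(1/t + 1/h)·log(K/ε))` steps of burn-in
and `O(Var·max{m/(ct), K/h}/(p·η²ε))` steps of averaging.  NOT CLAIMED: flows inexact within a sector; anything measured.  Literature grade
(cell rule): OWN COMPOSITION on Q6, N2, N3 and the typed [LevinPeres2017, Thm 12.21]; nothing new cited as a fact; no new bib keys.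
-/

noncomputable section

open Finset Function Matrix
open Literature.Probability.MarkovChains

namespace Summit.Ventures.LatticeQCDFlow.Scaling

variable {S : Type*} [Fintype S] [DecidableEq S] {K m : ℕ} {μ : Fin (K + 1) → S → ℝ} {M : Fin (K + 1) → S → S → ℝ}
  {w : Fin (K + 1) → ℝ} {t p : ℝ}

section SampleSize
variable (κ : Fin m → Fin K) (φ : Fin m → Equiv.Perm S) (A : Finset S)

/-- **THE VOLUME-FREE HONEST SAMPLE SIZE WITH SECTOR-EXACT FLOWS, GENERAL `S`, EVERY `K`.** [ours] -/
theorem sectorExact_timeAverage [Nontrivial S] (hK : 1 ≤ K) (hm : 1 ≤ m) (ht0 : 0 < t) (ht1 : t < 1) (hw0 : ∀ k, 0 ≤ w k)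
    (hw00 : 0 < w 0) (hw1 : ∑ k, w k = 1) (hμ : ∀ k x, 0 < μ k x) (hμ1 : ∀ k, ∑ u, μ k u = 1) (hφA : ∀ r u, φ r u ∈ A ↔ u ∈ A)
    {cin cout : Fin m → ℝ} (hcin : ∀ r, 0 < cin r) (hcout : ∀ r, 0 < cout r)
    (hexact : ∀ r u, μ (κ r).succ (φ r u) = (if u ∈ A then cin r else cout r) * μ 0 u)
    (hp0 : 0 < p) (hp1 : p ≤ 1) (hdom : ∀ r u, p * μ (κ r).succ (φ r u) ≤ μ 0 u)
    (hM : ∀ k, IsRowStochastic (M k)) (hMrev : ∀ k, DetailedBalance (μ k) (M k)) (hM0 : ∀ u v, M 0 u v = μ 0 v)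
    (hconf : ∀ k : Fin (K + 1), k ≠ 0 → ∀ u v, ¬(u ∈ A ↔ v ∈ A) → M k u v = 0)
    (hA : ∀ k b, 0 < ∑ u ∈ univ.filter (fun u => decide (u ∈ A) = b), μ k u)
    {a : ℝ} (ha0 : 0 < a) (ha : ∀ r, a ≤ min 1 (min (cin r / cout r) (cout r / cin r)))
    {c : ℕ} (hc1 : 1 ≤ c) (hc : ∀ p' : Fin K, c ≤ (univ.filter (fun r : Fin m => κ r = p')).card)
    (f : (Fin (K + 1) → S) → ℝ) {ε η : ℝ} (hε : 0 < ε) (hη : 0 < η) {r N : ℕ}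
    (hr : ⌈1 / (t * ((1 - t) * w 0) / (2 * t + (1 - t) * w 0) * min (a * c / m) (1 / (K + 1)))
          * Real.log (2 * (1 + K * (2 * t + (1 - t) * w 0) / (2 * t)) / (ε / 2))⌉₊ ≤ r) (hN : 0 < N)
    (hNvar : 4 * lawVariance (tensorFun μ) f / (η ^ 2 * ε) * (1 / (p * min (c * t / (3 * m)) ((1 - t) * w 0 / (7 * K)))) ≤ N)
    (x : Fin (K + 1) → S) :
    pathSum (fun y z : Fin (K + 1) → S =>
        t * ptGraphSwap μ (fun r : Fin m => (((0 : Fin (K + 1)), (κ r).succ) : Fin (K + 1) × Fin (K + 1))) φ y z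
          + (1 - t) * prodKernel w M y z) (N + r) x (fun ω =>
        if η ≤ |(∑ s : Fin N, f ((Matrix.vecCons x ω : Fin (N + r + 1) → (Fin (K + 1) → S))
              ⟨(s : ℕ) + r, by have := s.isLt; omega⟩)) / N - lawMean (tensorFun μ) f|
          then (1 : ℝ) else 0) ≤ ε := by
  have hmpos : (0 : ℝ) < m := Nat.cast_pos.mpr (by omega)
  have hKpos : (0 : ℝ) < K := Nat.cast_pos.mpr (by omega)
  have hstat : ∀ k : Fin (K + 1), k ≠ 0 → ∀ v, ∑ u, μ k u * M k u v = μ k v := fun k _ v => (hMrev k).isStationary (hM k).2 v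
  have hP := weightedScheme_isRowStochastic (t := t) (w := w)
    (ptGraphSwap_isRowStochastic (e := fun r : Fin m => (((0 : Fin (K + 1)), (κ r).succ) : Fin (K + 1) × Fin (K + 1))) (φ := φ) hμ)
    hM hw0 hw1 ht0.le ht1.le
  have hDB := weightedScheme_detailedBalance (w := w)
    (ptGraphSwap_detailedBalance (e := fun r : Fin m => (((0 : Fin (K + 1)), (κ r).succ) : Fin (K + 1) × Fin (K + 1))) (φ := φ) hμ) hMrev t
  have hirr := dominatedStar_isIrreducible_regimeFree κ φ ht0 ht1 hw0 hw00 hw1 hμ hM hM0 hc1 hc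
  have hε2 : 0 < ε / 2 := by linarith
  -- the volume-free burn-in of Q6
  set r₀ : ℕ := ⌈1 / (t * ((1 - t) * w 0) / (2 * t + (1 - t) * w 0) * min (a * c / m) (1 / (K + 1)))
      * Real.log (2 * (1 + K * (2 * t + (1 - t) * w 0) / (2 * t)) / (ε / 2))⌉₊ with hr₀
  have hmix := sectorExact_mixingTime_le κ φ A hm ht0 ht1 hw0 hw00 hw1 hμ hμ1 hφA hcin hcout hexact hM hM0 hstat hconf hA ha0 ha hc1 hc hε2
  have ht₀ : worstTvDist (fun y z : Fin (K + 1) → S =>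
      t * ptGraphSwap μ (fun r : Fin m => (((0 : Fin (K + 1)), (κ r).succ) : Fin (K + 1) × Fin (K + 1))) φ y z
        + (1 - t) * prodKernel w M y z) (tensorFun μ) r₀ ≤ ε / 2 := by
    have hh0 : 0 < (1 - t) * w 0 := mul_pos (by linarith) hw00
    set ρ := t * ((1 - t) * w 0) / (2 * t + (1 - t) * w 0) * min (a * c / m) (1 / (K + 1)) with hρ
    have hρ0 : 0 < ρ := by
      have : 0 < min (a * c / (m : ℝ)) (1 / ((K : ℝ) + 1)) := lt_min (by positivity) (by positivity)
      positivity
    have hρ1 : ρ ≤ 1 := by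
      have h1 : t * ((1 - t) * w 0) / (2 * t + (1 - t) * w 0) ≤ 1 := by
        rw [div_le_one (by positivity)]; nlinarith [mul_pos ht0 hh0]
      have h2 : min (a * c / (m : ℝ)) (1 / ((K : ℝ) + 1)) ≤ 1 := (min_le_right _ _).trans (by
        rw [div_le_one (by positivity)]; linarith)
      have h3 : 0 ≤ min (a * c / (m : ℝ)) (1 / ((K : ℝ) + 1)) := le_min (by positivity) (by positivity)
      calc ρ ≤ 1 * 1 := mul_le_mul h1 h2 h3 zero_le_one
        _ = 1 := one_mul 1
    exact (sectorExact_worstTvDist_le_tuned κ φ A hm ht0 ht1 hw0 hw00 hw1 hμ hμ1 hφA hcin hcout hexact hM hM0 hstat hconf hA ha0.le ha hc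
      r₀).trans (geom_le_of_ge_log hρ0 hρ1 (by positivity) hε2 (Nat.le_ceil _))
  -- the run length through `Gap ≥ p·min{ct/(3m), (1−t)w_0/(7K)}`
  have hgap := dominatedStar_spectralGap_ge_regimeFree κ φ hK hm ht0 ht1 hw0 hw00 hw1 hμ hμ1 hM hMrev hM0 hp0 hp1 hdom hc1 hc
  have hGpos : 0 < p * min (c * t / (3 * m)) ((1 - t) * w 0 / (7 * K)) := mul_pos hp0 (lt_min (by positivity) (by
    have : 0 < 1 - t := by linarith
    positivity))
  have hγinv : (spectralGap (tensorFun μ) (fun y z : Fin (K + 1) → S =>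
      t * ptGraphSwap μ (fun r : Fin m => (((0 : Fin (K + 1)), (κ r).succ) : Fin (K + 1) × Fin (K + 1))) φ y z
        + (1 - t) * prodKernel w M y z))⁻¹ ≤ 1 / (p * min (c * t / (3 * m)) ((1 - t) * w 0 / (7 * K))) := by
    rw [← one_div]; exact one_div_le_one_div_of_le hGpos hgap
  have hV : 0 ≤ 4 * lawVariance (tensorFun μ) f / (η ^ 2 * ε) :=
    div_nonneg (mul_nonneg (by norm_num) (lawVariance_nonneg (fun z => (tensorFun_pos hμ z).le) f)) (by positivity)
  exact LevinPeres2017_thm_12_21 (fun z => tensorFun_pos hμ z) (sum_tensorFun_eq_one _ hμ1) hP hDB hirr f hε hη ht₀ (hmix.trans hr) hN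
    ((mul_le_mul_of_nonneg_left hγinv hV).trans hNvar) x

end SampleSize

end Summit.Ventures.LatticeQCDFlow.Scaling

end
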